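import Literature.MathematicalPhysics.QuantumFieldTheory.Balaban1983to89.B9Eq3115KnitCubeLetterY
import Literature.MathematicalPhysics.QuantumFieldTheory.Balaban1983to89.B9B8KnitBondAvgSupport

/-!
# `Balaban1983to89.B9KnitCubeRowAgreementY` — [Balaban1985BackgroundPropagators] (3.105) p. 414 («Similarly for averaging operators») AT THE KNIT PAIRS:
# the averaging term `Q*(U)aQ(U)` of the member (dag-n06-l's knit letter `QknitY` and its generic adjoint) and `Q*_□(U)a_□Q_□(U)` of the cube sequence
# (`QknitCubeY`, `QsknitCubeY`) have THE SAME ROWS AND THE SAME COLUMNS at the fine bonds carrying the cut-off of record `h^T_□` — for EVERY `U`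

T. Bałaban, *Propagators for lattice gauge theories in a background field*, Commun. Math. Phys. **99** (1985) 389–434 [Balaban1985BackgroundPropagators] = [B9]:
(3.105) p. 414 («Δ_aG₀ = I − Σ_□K(h_□)G_□h_□ − … = I − R»; the difference `Δ_a − Δ_{a,□}` enters ONLY through `DPD* − DP_□D*`: «Similarly for averaging operators»),
(3.87)–(3.88) p. 409 (`G₀ = Σ_□ h_□G_□h_□`, `supp h_□ ⊂ □̃`), p. 408 («Ω_{j+1}(□) = □̃³ ∩ B^{j+1}(Λ_{j+1}). We take Ω_j(□) = □̃⁴ … Ω₀(□) ⊂ □̃⁵»), p. 409 l. 1–5,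
(3.12)–(3.14) p. 393 («Q … is a local operator»); T. Bałaban, *Averaging operations for lattice gauge theories*, Commun. Math. Phys. **98** (1985) 17–51
[Balaban1985Averaging]: p. 24 (locality after (43): the double block `B^j(c₋) ∪ B^j(c₊)`); T. Bałaban, *Propagators and renormalization transformations … II*,
Commun. Math. Phys. **96** (1984) 223–250 [Balaban1984PropagatorsII]: (2.1)–(2.4) p. 224, (2.20) p. 226, (2.36) p. 229; *… I*, Commun. Math. Phys. **95** (1984) 17–40
[Balaban1984PropagatorsI]: (1.18) p. 20.

WHY THIS FILE (seat dag-n06-d g34).  ✓`B9DirichletBondCubePairY.eq3105Q(T)_hT_GDirCY` — (3.105) and its transpose at the member's `Δ_a[𝔮][G′](U)` with print's `G_□(U)`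
of the cube sequences — display a ROW (resp. COLUMN) AGREEMENT hypothesis: at every fine bond `f` with `h^T_□(f₋) ≠ 0`, `(𝔮⋆(U)a𝔮(U)A)(f) = (𝔮⋆_□(U)a_□𝔮_□(U)A)(f)`
(resp. the images of the cut-off fields `h_□·A` agree everywhere).  r05 proved it for the straight-contour pairs (✓`B9CubeBondRowAgreement(NearH)`).  This file proves
it for the KNIT pairs of record `(QknitY, adjTrY ∘ QknitY)` and `(QknitCubeY, QsknitCubeY)` — the same composite kernel `knitRowY` read at the index bonds of the two
sequences — by r05's route: a bijection of the non-vanishing summands (index bonds whose DOUBLE BLOCK contains a bond of `supp h^T_□` are index bonds of BOTH sequences,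
✓`lamBond_domCube_iff_of_nearH` + ✓`nearH_ends_of_double_block`) and the equality of the summands on common pairs (✓`wCubeBond_eq_of_lamBond`):
* §1 geometry of the dependency sets: a bond of `knitDepP i (j, c)` issues from the double block `B^j(c₋) ∪ B^j(c₊)` (`ends_of_mem_knitDepP`, via t2s-1
  ✓`iterBlockOf_transl_zero`), the level window `j ≤ j(□) + 2` and `NearH □` of both base points when that bond carries `h^T_□`, hence ★ the common-index-bond
  facts `lamBond_member_of_mem_knitDepP ∕ lamBond_cube_of_mem_knitDepP`;
* §2 the normal forms of `(adjTrY (Q U) (a (Q U A)))(f)` for both letters as sums of one summand `knitSummY` over the pairs, and ★★ the ROW and COLUMN agreements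
  `knit_rows_agree_of_hTY ∕ knit_cols_agree_of_hTY` — LITERALLY the `hrow ∕ hcol` hypotheses of ✓`eq3105Q(T)_hT_GDirCY` at the knit pairs, for every `U`, `A`;
* §3 at the stage's knit families OF RECORD `(qKnitOfRecord N θ i, qsKnitOfRecord N θ i)` (def-Y): the two agreements, and ★★★ (3.105) and its transpose at the member's
  `Δ_a[𝔮ʳᵉᶜ](U)` with `G_□(U) = GDirCKY i □ Pl_□ B_□ U` (the (C) letter of record), NO agreement hypothesis left: `eq3105Q_hT_GDirCKY ∕ eq3105QT_hT_GDirCKY` (displayed: the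
  (3.101) rows, the bond-support rows, the regime, the cut-offs `ζ_□̃`).

HONEST SCOPE.  Exact finite algebra + the [B6] block geometry of r05's files BY NAME; no inequality of the papers.  Count-neutral (`--supports stmt-QuantumFields-27239`);
N06 NOT discharged; one finite 𝕋⁴ programme at fixed `ε` — nothing continuum ∕ OS ∕ mass gap ∕ Clay; the Yang–Mills mass gap is NOT proved by any of this.  NEW file;
nothing landed is modified; no `sorry`, no `axiom`, no `instance`, no `notation`.  Net new unproved facts: 0 (one bookkeeping `def` — the summand — and theorems).
-/

noncomputable section

open scoped BigOperators

namespace Literature.MathematicalPhysics.QuantumFieldTheory.Balaban1983to89.B9KnitCubeRowAgreementY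

open B7Prop1Explicit renaming Site → LSite
open B7Prop1Explicit (e e_apply)
open B7Prop1Local (InBox loK bondHiK)
open B10Eq27TorusAxialLog (transl transl_add_e)
open B5Eq118OneStroke (iterBlockOf)
open B6GlobalChartV1 (PV domT toBox)
open B6KLevelCensusIndexV1 (KIdx)
open B6Cover236MultiLevelBlocks (cubes)
open B6Partition118KLevelTorus (hT)
open B15DeterminingSets (embIter)
open B9CubeSequence408 (NearH)
open B9CubeBondWeights (domCube wCubeBond wCubeBond_eq_of_lamBond)
open B9CubeIndexBondsNearH (lamBond_domCube_iff_of_nearH)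
open B9CubeLettersOpsL0 (cubeFamY levCubeY levCubeY_le_levY)
open B9CubeLettersBondOpsL0 (IBondCubeY aCubeY aKc)
open B9CubeLettersCovarianceL0 (aKc_eq_diagonal)
open B9CubeBondRowAgreementNearH (side_conds levY_le_of_hT_ne_zero nearH_ends_of_double_block)
open B9B8KnitBondAvgSupport (iterBlockOf_transl_zero)
open B9Thm37CubeCoverCommutators (cutMulY cutMulY_apply hTY hTY_apply)
open B9Eq3104CutoffCommutators (hBdY hBdY_apply DPDsY)
open B9Eq3105OfLocalInverseQ (deltaLocQY KhBQY)
open B9Eq3115KnitLetterY (QknitY)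
open B9Eq3115KnitCubeLetterY (zSrcP knitRowY knitDepP mem_knitDepP transl_zero_zSrcP QknitY_apply_eq_knitRowY QknitCubeY QknitCubeY_apply QsknitCubeY QsknitCubeY_apply
  knitRowY_eq_zero_of_forall GDirCKY GDirCKY_eq)
open B9DirichletBondCubePairY (padDeltaLocCY GDirCY eq3105Q_hT_GDirCY eq3105QT_hT_GDirCY)
open Node00
open Node00.OpsYNablaBridge (chartY)
open Node00.OpsYQLetter (adjTrY adjTrY_apply trSesqY unitFnY unitFnY_apply_of_ne qKnitOfRecord qsKnitOfRecord)
open scoped Matrix Matrix.Norms.L2Operator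

variable {d ℓ : ℕ} {hd : 1 ≤ d + 1} {hL : Odd (ℓ + 1) ∧ 1 < ℓ + 1} {b₀ b₁ : ℝ}

/-! ## §1 Geometry of the dependency sets: double block, level window, `NearH` of the base points, common index bonds -/

section Geometry

variable (i : KIdx d ℓ hd hL b₀ b₁) (q : ↥(cubes (toKT i).D.toDomains))

/-- [folklore] Euclidean quotient pinned by a half-open interval: `a / P = w ↔ P·w ≤ a < P·w + P` (`P > 0`). -/
private theorem ediv_eq_iff_of_pos {P : ℤ} (hP : 0 < P) {a w : ℤ} : a / P = w ↔ P * w ≤ a ∧ a < P * w + P := by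
  rw [le_antisymm_iff, ← Int.lt_add_one_iff, Int.ediv_lt_iff_lt_mul hP, Int.le_ediv_iff_mul_le hP]
  have h1 : (w + 1) * P = P * w + P := by ring
  have h2 : w * P = P * w := mul_comm _ _
  rw [h1, h2]
  exact and_comm

/-- a point of the box `[Lʲz, Lʲz + (Lʲ − 1)𝟙 + Lʲe_κ]` of `ℤ^{d+1}` has block label `z` or `z + e_κ` (coordinatewise Euclidean quotient by `Lʲ`).
[cite: Balaban1985Averaging, p.24 (the double block after (43)); Balaban1984PropagatorsI, (1.6) p.18] -/
theorem quot_of_inBox {j : ℕ} {z x : LSite (d + 1)} {κ : Fin (d + 1)} (hx : InBox (loK (ℓ + 1) j z) (bondHiK (ℓ + 1) j z κ) x) :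
    (fun ν => x ν / (((ℓ + 1) ^ j : ℕ) : ℤ)) = z ∨ (fun ν => x ν / (((ℓ + 1) ^ j : ℕ) : ℤ)) = z + e κ := by
  have hPc : (((ℓ + 1) ^ j : ℕ) : ℤ) = ((ℓ + 1 : ℕ) : ℤ) ^ j := by norm_cast
  have hP : (0 : ℤ) < ((ℓ + 1 : ℕ) : ℤ) ^ j := by positivity
  simp only [hPc]
  -- off the direction `κ` the quotient is `z ν`
  have hoff : ∀ ν, ν ≠ κ → x ν / ((ℓ + 1 : ℕ) : ℤ) ^ j = z ν := fun ν hν => by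
    obtain ⟨h1, h2⟩ := hx ν
    simp only [loK] at h1
    simp only [bondHiK, if_neg hν, add_zero] at h2
    rw [ediv_eq_iff_of_pos hP]
    constructor <;> linarith
  -- along `κ` it is `z κ` or `z κ + 1`
  obtain ⟨h1, h2⟩ := hx κ
  simp only [loK] at h1
  simp only [bondHiK, if_true] at h2
  by_cases hlt : x κ < ((ℓ + 1 : ℕ) : ℤ) ^ j * z κ + ((ℓ + 1 : ℕ) : ℤ) ^ j
  · left
    funext ν
    by_cases hν : ν = κ
    · subst hν
      rw [ediv_eq_iff_of_pos hP]
      exact ⟨h1, hlt⟩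
    · exact hoff ν hν
  · right
    funext ν
    by_cases hν : ν = κ
    · subst hν
      rw [Pi.add_apply, e_apply, if_pos rfl, ediv_eq_iff_of_pos hP]
      constructor <;> linarith
    · rw [Pi.add_apply, e_apply, if_neg hν, add_zero]
      exact hoff ν hν

/-- ★ **A BOND OF THE DEPENDENCY SET ISSUES FROM THE DOUBLE BLOCK**: `b ∈ knitDepP i (j, c) ⟹ B^j(b₋) = c₋ ∨ B^j(b₋) = c₊` (t2s-1 ✓`iterBlockOf_transl_zero`).
[cite: Balaban1985Averaging, p.24 (after (43)); Balaban1984PropagatorsI, (1.18) p.20; Balaban1985BackgroundPropagators, (3.12)–(3.14) p.393] -/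
theorem ends_of_mem_knitDepP (p : (j : Fin (i.k + 1)) × PBond (PV d ℓ i.m i.K hd hL) (j : ℕ)) {b : FBondY i} (hb : b ∈ knitDepP i p) :
    iterBlockOf (p.1 : ℕ) b.src = p.2.src ∨ iterBlockOf (p.1 : ℕ) b.src = p.2.tgt := by
  obtain ⟨x, μ, hx, -, rfl⟩ := hb
  have hj : (p.1 : ℕ) ≤ i.m + i.K := (Nat.lt_succ_iff.1 p.1.2).trans i.hk
  change iterBlockOf (p.1 : ℕ) (transl (0 : Site (PV d ℓ i.m i.K hd hL) 0) x) = _ ∨ iterBlockOf (p.1 : ℕ) (transl (0 : Site (PV d ℓ i.m i.K hd hL) 0) x) = _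
  rw [iterBlockOf_transl_zero hj x]
  rcases quot_of_inBox hx with h | h
  · left; rw [h, transl_zero_zSrcP]
  · right; rw [h, transl_add_e, transl_zero_zSrcP]; rfl

/-- the member's index bonds: a bond of `supp h^T_□` in the double block of `y` forces the LEVEL WINDOW `j(y) ≤ j(□) + 2`.
[cite: Balaban1984PropagatorsII, (2.2)–(2.4) p.224; Balaban1985BackgroundPropagators, p.408, (3.87)–(3.88) p.409] -/
theorem lvl_le_of_mem_knitDepP_of_hT (ι : IBondY i) {b : FBondY i} (hb : b ∈ knitDepP i ι.1) (hf : hT (toKT i).D q (toBox i.hN b.src) ≠ 0) :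
    (ι.1.1 : ℕ) ≤ q.1.1 + 2 := by
  obtain ⟨-, -, -, -, hRM⟩ := side_conds i
  have h1 := (B6Ineq2142KLevelV1.lev_ends_bounds i.hN i.D i.hk (le_trans one_le_two i.hk2) hRM ι (ends_of_mem_knitDepP i ι.1 hb)).1
  have h2 := levY_le_of_hT_ne_zero i q hf
  change (ι.1.1 : ℕ) - 1 ≤ levY i (toBox i.hN b.src) at h1
  omega

/-- the cube sequence's index bonds: the same level window (`lev_□ ≤ lev`). [cite: Balaban1984PropagatorsII, (2.2)–(2.4) p.224; Balaban1985BackgroundPropagators, p.408, p.409 l.1–5] -/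
theorem lvl_le_of_mem_knitDepP_of_hT' (ι : IBondCubeY i q) {b : FBondY i} (hb : b ∈ knitDepP i ι.1) (hf : hT (toKT i).D q (toBox i.hN b.src) ≠ 0) :
    (ι.1.1 : ℕ) ≤ q.1.1 + 2 := by
  obtain ⟨-, -, -, -, hRM⟩ := side_conds i
  have h1 := (B6Ineq2142KLevelV1L0.lev_ends_bounds i.hN (cubeFamY i q) i.hk hRM ι (ends_of_mem_knitDepP i ι.1 hb)).1
  have h2 := levY_le_of_hT_ne_zero i q hf
  have h3 := levCubeY_le_levY i q (toBox i.hN b.src)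
  change (ι.1.1 : ℕ) - 1 ≤ levCubeY i q (toBox i.hN b.src) at h1
  omega

/-- ★ member: a bond of `supp h^T_□` in the dependency set of `y` puts both base points of `y` in `NearH □`.
[cite: Balaban1985BackgroundPropagators, (3.105) p.414 («Similarly for averaging operators»), p.408; Balaban1985Averaging, p.24] -/
theorem nearH_ends_of_mem_knitDepP (ι : IBondY i) {b : FBondY i} (hb : b ∈ knitDepP i ι.1) (hf : hT (toKT i).D q (toBox i.hN b.src) ≠ 0) :
    NearH q (toBox i.hN (embIter (ι.1.1 : ℕ) ι.1.2.src)).1 ∧ NearH q (toBox i.hN (embIter (ι.1.1 : ℕ) ι.1.2.tgt)).1 :=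
  nearH_ends_of_double_block i q (Nat.lt_succ_iff.1 ι.1.1.2) (lvl_le_of_mem_knitDepP_of_hT i q ι hb hf) ι.1.2 (ends_of_mem_knitDepP i ι.1 hb) hf

/-- ★ cube sequence: the same. [cite: Balaban1985BackgroundPropagators, p.409 l.1–5, (3.105) p.414, p.408; Balaban1985Averaging, p.24] -/
theorem nearH_ends_of_mem_knitDepP' (ι : IBondCubeY i q) {b : FBondY i} (hb : b ∈ knitDepP i ι.1) (hf : hT (toKT i).D q (toBox i.hN b.src) ≠ 0) :
    NearH q (toBox i.hN (embIter (ι.1.1 : ℕ) ι.1.2.src)).1 ∧ NearH q (toBox i.hN (embIter (ι.1.1 : ℕ) ι.1.2.tgt)).1 :=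
  nearH_ends_of_double_block i q (Nat.lt_succ_iff.1 ι.1.1.2) (lvl_le_of_mem_knitDepP_of_hT' i q ι hb hf) ι.1.2 (ends_of_mem_knitDepP i ι.1 hb) hf

/-- ★★ **AN INDEX BOND OF THE CUBE SEQUENCE WHOSE DOUBLE BLOCK MEETS `supp h^T_□` IS AN INDEX BOND OF THE MEMBER.**
[cite: Balaban1985BackgroundPropagators, p.408 («Ω_{j+1}(□) = □̃³ ∩ B^{j+1}(Λ_{j+1})», «Ω₀(□) ⊂ □̃⁵»), p.409 l.1–5; Balaban1984PropagatorsII, (2.3) p.224] -/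
theorem lamBond_member_of_mem_knitDepP (ι : IBondCubeY i q) {b : FBondY i} (hb : b ∈ knitDepP i ι.1) (hf : hT (toKT i).D q (toBox i.hN b.src) ≠ 0) :
    (domT i.hN i.D i.hk).LamBond (ι.1.1 : ℕ) ι.1.2 :=
  have hn := nearH_ends_of_mem_knitDepP' i q ι hb hf
  (lamBond_domCube_iff_of_nearH i q (Nat.lt_succ_iff.1 ι.1.1.2) ι.1.2 hn.1 hn.2).1 ι.2

/-- ★★ **AN INDEX BOND OF THE MEMBER WHOSE DOUBLE BLOCK MEETS `supp h^T_□` IS AN INDEX BOND OF THE CUBE SEQUENCE.**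
[cite: Balaban1985BackgroundPropagators, p.408, p.409 l.1–5; Balaban1984PropagatorsII, (2.3) p.224] -/
theorem lamBond_cube_of_mem_knitDepP (ι : IBondY i) {b : FBondY i} (hb : b ∈ knitDepP i ι.1) (hf : hT (toKT i).D q (toBox i.hN b.src) ≠ 0) :
    (domCube i q).LamBond (ι.1.1 : ℕ) ι.1.2 :=
  have hn := nearH_ends_of_mem_knitDepP i q ι hb hf
  (lamBond_domCube_iff_of_nearH i q (Nat.lt_succ_iff.1 ι.1.1.2) ι.1.2 hn.1 hn.2).2 ι.2

/-- dictionary: def-Y's cut-off `hTY` read at a bond's source IS the cell's torus cut-off at the box chart (`rfl`). [cite: Balaban1985BackgroundPropagators, (3.87) p.409, dictionary] -/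
theorem hT_of_hTY {c : ↥(cubes (toKT i).D.toDomains)} {s : Site (PV d ℓ i.m i.K hd hL) 0} (h : hTY i c (chartY i s) ≠ 0) :
    hT (toKT i).D c (toBox i.hN s) ≠ 0 := h

end Geometry

/-! ## §2 The normal forms of the averaging terms and the row ∕ column agreement at the knit pairs -/

section Agreement

variable {N : ℕ} [Nonempty (Fin N)] (i : KIdx d ℓ hd hL b₀ b₁) (q : ↥(cubes (toKT i).D.toDomains))

/-- the `(a, b)`-entry summand of `(adjTrY (Q U) (a (Q U A)))(f)` at a pair `p` with weight `w`: `Σ_{c,e} conj((knitRowY U δ_f^{ab} p)_{ce})·(w·knitRowY U A p)_{ce}`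
(bookkeeping `def`). [cite: Balaban1985BackgroundPropagators, (3.13) p.393, (3.26) p.395, bookkeeping] -/
def knitSummY (U : CfgY (Matrix (Fin N) (Fin N) ℂ) i) (A : FBondY i → Matrix (Fin N) (Fin N) ℂ) (f : FBondY i) (a b : Fin N) (w : ℝ)
    (p : (j : Fin (i.k + 1)) × PBond (PV d ℓ i.m i.K hd hL) (j : ℕ)) : ℂ :=
  ∑ c, ∑ e, star (knitRowY i U (unitFnY f a b) p c e) * (((w : ℝ) : ℂ) • knitRowY i U A p) c e

/-- a summand at a pair that does not see `f` vanishes (the basis vector `δ_f^{ab}` is zero on `knitDepP i p`).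
[cite: Balaban1985BackgroundPropagators, (3.12)–(3.14) p.393 («Q … is a local operator»), bookkeeping] -/
theorem knitSummY_eq_zero_of_not_mem (U : CfgY (Matrix (Fin N) (Fin N) ℂ) i) (A : FBondY i → Matrix (Fin N) (Fin N) ℂ) {f : FBondY i} (a b : Fin N) (w : ℝ)
    {p : (j : Fin (i.k + 1)) × PBond (PV d ℓ i.m i.K hd hL) (j : ℕ)} (hf : f ∉ knitDepP i p) : knitSummY i U A f a b w p = 0 := by
  have h0 : knitRowY i U (unitFnY f a b) p = 0 :=
    knitRowY_eq_zero_of_forall i U p fun b' hb' => by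
      have hne : b' ≠ f := by rintro rfl; exact hf hb'
      funext c e
      rw [unitFnY_apply_of_ne hne, Matrix.zero_apply]
  simp only [knitSummY, h0, Matrix.zero_apply, star_zero, zero_mul, Finset.sum_const_zero]

/-- a summand at a pair whose dependency set misses the support of `A` vanishes. [cite: Balaban1985BackgroundPropagators, (3.12)–(3.14) p.393, bookkeeping] -/
theorem knitSummY_eq_zero_of_forall (U : CfgY (Matrix (Fin N) (Fin N) ℂ) i) {A : FBondY i → Matrix (Fin N) (Fin N) ℂ} (f : FBondY i) (a b : Fin N) (w : ℝ)
    {p : (j : Fin (i.k + 1)) × PBond (PV d ℓ i.m i.K hd hL) (j : ℕ)} (hA : ∀ b' ∈ knitDepP i p, A b' = 0) : knitSummY i U A f a b w p = 0 := by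
  have h0 : knitRowY i U A p = 0 := knitRowY_eq_zero_of_forall i U p hA
  simp only [knitSummY, h0, smul_zero, Matrix.zero_apply, mul_zero, Finset.sum_const_zero]

/-- ★ **NORMAL FORM (member)**: `(adjTrY (Q(U)) (a(Q(U)A)))(f)_{ab} = Σ_{y ∈ 𝔅} knitSummY U A f a b (w y) y.1` (`a = diag w`, def-Y `aK_eq_diagonal`).
[cite: Balaban1985BackgroundPropagators, (3.13) p.393, (3.26) p.395; Balaban1984PropagatorsII, (2.20) p.226] -/
theorem adjTrY_aY_QknitY_apply (U : CfgY (Matrix (Fin N) (Fin N) ℂ) i) (A : FBondY i → Matrix (Fin N) (Fin N) ℂ) (f : FBondY i) (a b : Fin N) :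
    adjTrY (QknitY i U) (aY i (QknitY i U A)) f a b = ∑ ι : IBondY i, knitSummY i U A f a b (i.w ι) ι.1 := by
  rw [adjTrY_apply, trSesqY]
  refine Finset.sum_congr rfl fun ι _ => ?_
  rw [knitSummY, aY, aK_eq_diagonal, liftMatY_diagonal_apply]
  rfl

/-- ★ **NORMAL FORM (cube sequence)**: `(adjTrY (Q_□(U)) (a_□(Q_□(U)A)))(f)_{ab} = Σ_{y ∈ 𝔅(□)} knitSummY U A f a b (w_□ y) y.1` (`a_□ = diag w_□`, r05 `aKc_eq_diagonal`).
[cite: Balaban1985BackgroundPropagators, (3.13) p.393, (3.26) p.395, p.409 l.1–5; Balaban1984PropagatorsII, (2.20) p.226] -/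
theorem adjTrY_aCubeY_QknitCubeY_apply (U : CfgY (Matrix (Fin N) (Fin N) ℂ) i) (A : FBondY i → Matrix (Fin N) (Fin N) ℂ) (f : FBondY i) (a b : Fin N) :
    adjTrY (QknitCubeY i q U) (aCubeY i q (QknitCubeY i q U A)) f a b = ∑ ι : IBondCubeY i q, knitSummY i U A f a b (wCubeBond i q ι) ι.1 := by
  rw [adjTrY_apply, trSesqY]
  refine Finset.sum_congr rfl fun ι _ => ?_
  rw [knitSummY, aCubeY, aKc_eq_diagonal, liftMatY_diagonal_apply]
  rfl

/-- ★★ **THE AGREEMENT OF THE AVERAGING TERMS, ABSTRACT FORM**: if every index bond of the cube sequence with a non-vanishing summand is an index bond of the member and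
conversely, then `(Q*_□(U)a_□Q_□(U)A)(f) = (Q*(U)aQ(U)A)(f)` at the knit pairs (bijection of the non-vanishing summands; weights by ✓`wCubeBond_eq_of_lamBond`).
[cite: Balaban1985BackgroundPropagators, (3.105) p.414 («Similarly for averaging operators»), p.409 l.1–5; Balaban1984PropagatorsII, (2.3) p.224, (2.20) p.226] -/
theorem knit_agree_of_lamBond (U : CfgY (Matrix (Fin N) (Fin N) ℂ) i) (A : FBondY i → Matrix (Fin N) (Fin N) ℂ) (f : FBondY i)
    (h1 : ∀ ι : IBondCubeY i q, (∃ a b, knitSummY i U A f a b (wCubeBond i q ι) ι.1 ≠ 0) → (domT i.hN i.D i.hk).LamBond (ι.1.1 : ℕ) ι.1.2)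
    (h2 : ∀ ι : IBondY i, (∃ a b, knitSummY i U A f a b (i.w ι) ι.1 ≠ 0) → (domCube i q).LamBond (ι.1.1 : ℕ) ι.1.2) :
    QsknitCubeY i q U (aCubeY i q (QknitCubeY i q U A)) f = adjTrY (QknitY i U) (aY i (QknitY i U A)) f := by
  classical
  rw [QsknitCubeY_apply]
  ext a b
  rw [adjTrY_aCubeY_QknitCubeY_apply, adjTrY_aY_QknitY_apply]
  refine Finset.sum_bij_ne_zero (fun ι _ hne => (⟨ι.1, h1 ι ⟨a, b, hne⟩⟩ : IBondY i)) (fun _ _ _ => Finset.mem_univ _)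
    (fun ι₁ _ _ ι₂ _ _ heq => by have h := Subtype.ext_iff.1 heq; exact Subtype.ext h) (fun ι' _ hne' => ?_) (fun ι _ hne => ?_)
  · -- surjectivity onto the non-vanishing summands of the member
    have hF : (domCube i q).LamBond (ι'.1.1 : ℕ) ι'.1.2 := h2 ι' ⟨a, b, hne'⟩
    refine ⟨⟨ι'.1, hF⟩, Finset.mem_univ _, ?_, rfl⟩
    exact fun h0 => hne' ((congrArg (fun w : ℝ => knitSummY i U A f a b w ι'.1) (wCubeBond_eq_of_lamBond i q ⟨ι'.1, hF⟩ ι'.2)).symm.trans h0)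
  · exact congrArg (fun w : ℝ => knitSummY i U A f a b w ι.1) (wCubeBond_eq_of_lamBond i q ι (h1 ι ⟨a, b, hne⟩))

/-- ★★ **THE ROW AGREEMENT AT THE BONDS OF `supp h^T_□`** — the hypothesis `hrow` of ✓`B9DirichletBondCubePairY.eq3105Q_hT_GDirCY` at the knit pairs: for every `U`, `A`
and every fine bond `f` with `h^T_□(f₋) ≠ 0`, `(adjTrY (Q(U)) (a(Q(U)A)))(f) = (Q*_□(U)(a_□(Q_□(U)A)))(f)`.
[cite: Balaban1985BackgroundPropagators, (3.105) p.414 («Similarly for averaging operators»), (3.87)–(3.88) p.409, p.409 l.1–5; Balaban1985Averaging, p.24] -/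
theorem knit_rows_agree_of_hTY (U : CfgY (Matrix (Fin N) (Fin N) ℂ) i) (A : FBondY i → Matrix (Fin N) (Fin N) ℂ) (f : FBondY i)
    (hf : hTY i q (chartY i f.src) ≠ 0) :
    adjTrY (QknitY i U) (aY i (QknitY i U A)) f = QsknitCubeY i q U (aCubeY i q (QknitCubeY i q U A)) f := by
  classical
  refine (knit_agree_of_lamBond i q U A f (fun ι ⟨a, b, hne⟩ => ?_) (fun ι ⟨a, b, hne⟩ => ?_)).symm
  · by_contra hD
    exact hne (knitSummY_eq_zero_of_not_mem i U A a b _ fun hmem => hD (lamBond_member_of_mem_knitDepP i q ι hmem (hT_of_hTY i hf)))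
  · by_contra hC
    exact hne (knitSummY_eq_zero_of_not_mem i U A a b _ fun hmem => hC (lamBond_cube_of_mem_knitDepP i q ι hmem (hT_of_hTY i hf)))

/-- ★★ **THE COLUMN AGREEMENT ON THE CUT-OFF FIELDS** — the hypothesis `hcol` of ✓`eq3105QT_hT_GDirCY` at the knit pairs: for every `U`, `A` and EVERY fine bond `f`,
`(adjTrY (Q(U)) (a(Q(U)(h^T_□·A))))(f) = (Q*_□(U)(a_□(Q_□(U)(h^T_□·A))))(f)` (an index bond whose row sees the cut-off field meets `supp h^T_□`). (transposed reading —
bookkeeping) [cite: Balaban1985BackgroundPropagators, (3.105) p.414, (3.87)–(3.88) p.409, p.409 l.1–5; Balaban1985Averaging, p.24] -/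
theorem knit_cols_agree_of_hTY (U : CfgY (Matrix (Fin N) (Fin N) ℂ) i) (A : FBondY i → Matrix (Fin N) (Fin N) ℂ) (f : FBondY i) :
    adjTrY (QknitY i U) (aY i (QknitY i U (cutMulY (hBdY i (hTY i q)) A))) f =
      QsknitCubeY i q U (aCubeY i q (QknitCubeY i q U (cutMulY (hBdY i (hTY i q)) A))) f := by
  classical
  have hsupp : ∀ (p : (j : Fin (i.k + 1)) × PBond (PV d ℓ i.m i.K hd hL) (j : ℕ)),
      (¬ ∃ b' ∈ knitDepP i p, hTY i q (chartY i b'.src) ≠ 0) → ∀ b' ∈ knitDepP i p, cutMulY (hBdY i (hTY i q)) A b' = 0 := fun p hp b' hb' => by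
    rw [cutMulY_apply, hBdY_apply]
    by_cases h0 : hTY i q (chartY i b'.src) = 0
    · rw [h0, Complex.ofReal_zero, zero_smul]
    · exact absurd ⟨b', hb', h0⟩ hp
  refine (knit_agree_of_lamBond i q U _ f (fun ι ⟨a, b, hne⟩ => ?_) (fun ι ⟨a, b, hne⟩ => ?_)).symm
  · by_contra hD
    refine hne (knitSummY_eq_zero_of_forall i U f a b _ (hsupp ι.1 fun ⟨b', hb', hb0⟩ => hD ?_))
    exact lamBond_member_of_mem_knitDepP i q ι hb' (hT_of_hTY i hb0)
  · by_contra hC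
    refine hne (knitSummY_eq_zero_of_forall i U f a b _ (hsupp ι.1 fun ⟨b', hb', hb0⟩ => hC ?_))
    exact lamBond_cube_of_mem_knitDepP i q ι hb' (hT_of_hTY i hb0)

end Agreement

/-! ## §3 At the stage's knit families of record: the agreements, and (3.105) + transpose with the (C) letter `G_□(U) = GDirCKY`, no agreement hypothesis left -/

section Record

variable {N : ℕ} [Nonempty (Fin N)] {θ : Stage3Params} (i : KIdx θ.d₆ θ.ℓ₆ θ.hd' θ.hL' θ.b₀ θ.b₁)

/-- ★★ the ROW agreement at the knit families OF RECORD `(qKnitOfRecord, qsKnitOfRecord)` of the stage (def-Y's names; `rfl`-faces of `QknitY ∕ adjTrY`).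
[cite: Balaban1985BackgroundPropagators, (3.105) p.414, (3.87)–(3.88) p.409, p.409 l.1–5] -/
theorem knitRecord_rows_agree_of_hTY (q : ↥(cubes (toKT i).D.toDomains)) (U : CfgY (Matrix (Fin N) (Fin N) ℂ) i) (A : FBondY i → Matrix (Fin N) (Fin N) ℂ)
    (f : FBondY i) (hf : hTY i q (chartY i f.src) ≠ 0) :
    qsKnitOfRecord N θ i U (aY i (qKnitOfRecord N θ i U A)) f = QsknitCubeY i q U (aCubeY i q (QknitCubeY i q U A)) f :=
  knit_rows_agree_of_hTY i q U A f hf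

/-- ★★ the COLUMN agreement at the knit families of record. (transposed reading — bookkeeping) [cite: Balaban1985BackgroundPropagators, (3.105) p.414, (3.87)–(3.88) p.409, p.409 l.1–5] -/
theorem knitRecord_cols_agree_of_hTY (q : ↥(cubes (toKT i).D.toDomains)) (U : CfgY (Matrix (Fin N) (Fin N) ℂ) i) (A : FBondY i → Matrix (Fin N) (Fin N) ℂ)
    (f : FBondY i) :
    qsKnitOfRecord N θ i U (aY i (qKnitOfRecord N θ i U (cutMulY (hBdY i (hTY i q)) A))) f =
      QsknitCubeY i q U (aCubeY i q (QknitCubeY i q U (cutMulY (hBdY i (hTY i q)) A))) f :=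
  knit_cols_agree_of_hTY i q U A f

/-- ★★★ **(3.105) AT THE MEMBER's `Δ_a[𝔮ʳᵉᶜ][G′](U)` (knit families of record) WITH PRINT's `G_□(U)` OF THE CUBE SEQUENCES AT THEIR KNIT PAIRS** (the (C) letter of record
`GDirCKY i □ Pl_□ B_□`), `E_□ ≡ 0`, the row agreement DISCHARGED:
`Δ_a(U)·Σ_□ h_□G_□(U)h_□ = 1 − Σ_□K(h_□)G_□h_□ − Σ_□(1 − ζ_□̃)DPD*(h_□G_□h_□) − Σ_□ζ_□̃(DPD* − Pl_□)(h_□G_□h_□) − Σ_□ζ_□̃P_{l,1}(∂h_□)G_□h_□` — displayed: the (3.101) rows `hP1`,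
the bond-support rows `hB`, the regime `hU` (Cor. 3.6 for the sequences), the cut-offs `ζ_□̃ = 1` on `supp h_□`.
[cite: Balaban1985BackgroundPropagators, (3.105) p.414, p.409 l.1–5, (3.87) p.409, Cor. 3.6 p.408] -/
theorem eq3105Q_hT_GDirCKY (parS : SiteParY (Matrix (Fin N) (Fin N) ℂ) i) (Gp : SiteOpY (Matrix (Fin N) (Fin N) ℂ) i) (U : CfgY (Matrix (Fin N) (Fin N) ℂ) i)
    (ζ : ↥(cubes i.D.toDomains) → SiteY i → ℝ) (hζ : ∀ c z, hTY i c z ≠ 0 → ζ c z = 1)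
    (Pl : ↥(cubes i.D.toDomains) → CfgY (Matrix (Fin N) (Fin N) ℂ) i → Module.End ℂ (FBondY i → Matrix (Fin N) (Fin N) ℂ))
    (P1l : ↥(cubes i.D.toDomains) → Module.End ℂ (FBondY i → Matrix (Fin N) (Fin N) ℂ))
    (hP1 : ∀ c : ↥(cubes i.D.toDomains), Pl c U * cutMulY (hBdY i (hTY i c)) = cutMulY (hBdY i (hTY i c)) * Pl c U + P1l c)
    (B : ↥(cubes i.D.toDomains) → Finset (FBondY i)) (hB : ∀ c b, hBdY i (hTY i c) b ≠ 0 → b ∈ B c)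
    (hU : ∀ c : ↥(cubes i.D.toDomains), IsUnit (padDeltaLocCY i c (QknitCubeY i c) (QsknitCubeY i c) (Pl c) (B c) U)) :
    deltaAQY i (qKnitOfRecord N θ i) (qsKnitOfRecord N θ i) parS Gp U *
        ∑ c : ↥(cubes i.D.toDomains), cutMulY (hBdY i (hTY i c)) * GDirCKY i c (Pl c) (B c) U * cutMulY (hBdY i (hTY i c)) =
      1 - ∑ c : ↥(cubes i.D.toDomains), KhBQY i (hTY i c) (qKnitOfRecord N θ i) (qsKnitOfRecord N θ i) U * GDirCKY i c (Pl c) (B c) U * cutMulY (hBdY i (hTY i c))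
        - ∑ c : ↥(cubes i.D.toDomains), (1 - cutMulY (hBdY i (ζ c))) * DPDsY i parS Gp U *
            (cutMulY (hBdY i (hTY i c)) * GDirCKY i c (Pl c) (B c) U * cutMulY (hBdY i (hTY i c)))
        - ∑ c : ↥(cubes i.D.toDomains), cutMulY (hBdY i (ζ c)) * (DPDsY i parS Gp U - Pl c U) *
            (cutMulY (hBdY i (hTY i c)) * GDirCKY i c (Pl c) (B c) U * cutMulY (hBdY i (hTY i c)))
        - ∑ c : ↥(cubes i.D.toDomains), cutMulY (hBdY i (ζ c)) * P1l c * GDirCKY i c (Pl c) (B c) U * cutMulY (hBdY i (hTY i c)) := by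
  have h := eq3105Q_hT_GDirCY i (qKnitOfRecord N θ i) (qsKnitOfRecord N θ i) parS Gp U ζ hζ (QknitCubeY i) (QsknitCubeY i) Pl P1l hP1 B hB hU
    fun c A f hf => knitRecord_rows_agree_of_hTY i c U A f hf
  exact h

/-- ★★★ **THE TRANSPOSE OF (3.105) AT THE KNIT FAMILIES OF RECORD**, `E♯_□ ≡ 0`, the column agreement DISCHARGED. (transposed reading — bookkeeping; print displays only the left form)
[cite: Balaban1985BackgroundPropagators, (3.105) p.414, p.409 l.1–5, (3.87) p.409, Cor. 3.6 p.408] -/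
theorem eq3105QT_hT_GDirCKY (parS : SiteParY (Matrix (Fin N) (Fin N) ℂ) i) (Gp : SiteOpY (Matrix (Fin N) (Fin N) ℂ) i) (U : CfgY (Matrix (Fin N) (Fin N) ℂ) i)
    (ζ : ↥(cubes i.D.toDomains) → SiteY i → ℝ) (hζ : ∀ c z, hTY i c z ≠ 0 → ζ c z = 1)
    (Pl : ↥(cubes i.D.toDomains) → CfgY (Matrix (Fin N) (Fin N) ℂ) i → Module.End ℂ (FBondY i → Matrix (Fin N) (Fin N) ℂ))
    (P1l : ↥(cubes i.D.toDomains) → Module.End ℂ (FBondY i → Matrix (Fin N) (Fin N) ℂ))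
    (hP1 : ∀ c : ↥(cubes i.D.toDomains), Pl c U * cutMulY (hBdY i (hTY i c)) = cutMulY (hBdY i (hTY i c)) * Pl c U + P1l c)
    (B : ↥(cubes i.D.toDomains) → Finset (FBondY i)) (hB : ∀ c b, hBdY i (hTY i c) b ≠ 0 → b ∈ B c)
    (hU : ∀ c : ↥(cubes i.D.toDomains), IsUnit (padDeltaLocCY i c (QknitCubeY i c) (QsknitCubeY i c) (Pl c) (B c) U)) :
    (∑ c : ↥(cubes i.D.toDomains), cutMulY (hBdY i (hTY i c)) * GDirCKY i c (Pl c) (B c) U * cutMulY (hBdY i (hTY i c))) *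
        deltaAQY i (qKnitOfRecord N θ i) (qsKnitOfRecord N θ i) parS Gp U =
      1 + ∑ c : ↥(cubes i.D.toDomains), cutMulY (hBdY i (hTY i c)) * GDirCKY i c (Pl c) (B c) U * KhBQY i (hTY i c) (qKnitOfRecord N θ i) (qsKnitOfRecord N θ i) U
        + ∑ c : ↥(cubes i.D.toDomains), cutMulY (hBdY i (hTY i c)) * GDirCKY i c (Pl c) (B c) U * P1l c
        - ∑ c : ↥(cubes i.D.toDomains), cutMulY (hBdY i (hTY i c)) * GDirCKY i c (Pl c) (B c) U * cutMulY (hBdY i (hTY i c)) *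
            (cutMulY (hBdY i (ζ c)) * (DPDsY i parS Gp U - Pl c U))
        - ∑ c : ↥(cubes i.D.toDomains), cutMulY (hBdY i (hTY i c)) * GDirCKY i c (Pl c) (B c) U * cutMulY (hBdY i (hTY i c)) *
            ((1 - cutMulY (hBdY i (ζ c))) * DPDsY i parS Gp U) := by
  have h := eq3105QT_hT_GDirCY i (qKnitOfRecord N θ i) (qsKnitOfRecord N θ i) parS Gp U ζ hζ (QknitCubeY i) (QsknitCubeY i) Pl P1l hP1 B hB hU
    fun c A f => knitRecord_cols_agree_of_hTY i c U A f
  exact h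

end Record

end Literature.MathematicalPhysics.QuantumFieldTheory.Balaban1983to89.B9KnitCubeRowAgreementY

end
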